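import Summits.BirchSwinnertonDyer.BirchSwinnertonDyer.Theorems.ThetaPartnerAtTwoSignedControlAtTwoCoatesGreenbergOfCyclotomicZp
import Summits.BirchSwinnertonDyer.BirchSwinnertonDyer.Theorems.ThetaPartnerAtTwoSignedControlAtTwoRelaxedKummerCountAllLevels
import Literature.NumberTheory.EllipticCurves.CoatesGreenberg1996.CyclotomicZpExtensionDeeplyRamifiedProofs
import HarnessLib

/-!
# K4 `SignedControlAtTwo` (stmt-BirchSwinnertonDyer-20309) / `PublishedInputsGreenbergControlAtTwo`
# (stmt-24143, conj. 5): the printed input (I2) — Coates–Greenberg Cor. 3.2 — is now PROVED (universe 0)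

D-0154 (2) INPUTS, row 1, input (I2) `WeierstrassCurve.CoatesGreenberg1996_H1_formalGroup_trivial`
(Coates–Greenberg, Invent. Math. 124 (1996) Cor. 3.2 with Thm. 2.13, as quoted by Greenberg LNM 1716
p. 83: `H¹(K_v K_∞, 𝓕(𝔪̄)) = 0`).  The sibling file `…CoatesGreenbergOfCyclotomicZp` reduced (I2) to the
one-field base instance (B) `CoatesGreenberg1996.deeplyRamified_cyclotomicZpExtension_trace` («`K_v K_∞`
is deeply ramified», trace form).  (B) is now a THEOREM of the tree at universe `0`:
`CoatesGreenberg1996.deeplyRamified_cyclotomicZpExtension_trace_holds`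
(Literature `CoatesGreenberg1996/CyclotomicZpExtensionDeeplyRamifiedProofs`), proved from a
formalisation of Tate's almost étale lemma (Tate 1967 §3.2 Prop. 9) in the PAdicHodge framework
(`Literature/NumberTheory/PAdicHodge/TateAlmostEtale*.lean`: the finite-group gauge argument, Serre IV §1
Prop. 3 in norm form, monogenic integral generators of the layers `E(ζ_{p^n})`, explicit `ℤ_p[ζ]`,
cyclotomic orbit sums, torsion of `ℤ_p^×`, and the local assembly `exists_integral_fixed_norm_orbitSum_gt`).

THIS FILE records the consequences, THEOREMS ONLY (no statement is restated, no item is claimed):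

* `deeplyRamified_cyclotomic_trace_holds` : the general record DR = [CoGr] §2 (iii) for every field between
  `K_v K_∞^{cyc}` and `K̄_v`, universe `0`;
* `H1_goodModelKernel_trivial_holds` : [CoGr] Cor. 3.2 for good models, universe `0`;
* `CoatesGreenberg1996_H1_formalGroup_trivial_holds` : **(I2) AS TYPED, universe `0`** — the binder
  `hI2 : WeierstrassCurve.CoatesGreenberg1996_H1_formalGroup_trivial.{0}` of
  `signedControlAtTwo_of_pub3_of_I1_I2` and the `h2` of `not_isTorsion_of_supersingular_of_poitouTate`
  are discharged;
* `not_isTorsion_of_supersingular_of_relaxedSelmer` : Greenberg LNM 1716 Thm. 1.7 (supersingular case)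
  from (I1) alone; `not_isTorsion_of_supersingular_of_poitouTate'` : from PT over the layers alone;
* (sibling `…CoatesGreenbergUnconditionalK4`: K4 `SignedControlAtTwo` from the three Greenberg §4 facts
  and (I1) — `signedControlAtTwo_of_pub3_of_I1_I2` with `hI2` discharged).

HONEST FRAMING: universe `0` only (the PAdicHodge framework is typed over `F : Type`; every consumer in
this row is over `ℚ : Type` or a number field `K : Type`).  Proving the input (I2) makes the conditional
lines of this row unconditional IN (I2) AS TYPED; (I1), Cassels' Prop. 4.13, Prop. 4.12 and the other
displayed binders are untouched.  BSD is not proved by any of this; no item is closed by this file.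

References: [Tate1967] §3.2 Prop. 9; [CoatesGreenberg1996] Cor. 3.2, Thm. 2.13; [GreenbergLNM1716]
Thm. 1.7 (pp. 61–62), §2 pp. 83–84, §4; [IovitaZaharescu1999] Thm. 1.2 (iii).
-/

set_option autoImplicit false
-- the Theorems namespace of this sub repeats the summit name by design (D-0017 nested layout)
set_option linter.dupNamespace false

noncomputable section

open Literature.NumberTheory.EllipticCurves Literature.NumberTheory.EllipticCurves.CoatesGreenberg1996
  Literature.NumberTheory.GaloisRepresentations

namespace Summit.BirchSwinnertonDyer.BirchSwinnertonDyer.Theorems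

/-- **DR holds (universe `0`)**: the Coates–Greenberg record `deeplyRamified_cyclotomic_trace`
([CoGr] §2 p. 143 (iii) / Thm. 2.13 for every closed `G' ≤ (ker κ)_v` meeting `ker κ`), from the proved
one-field instance (B) through `deeplyRamified_cyclotomic_trace_of_cyclotomicZpExtension`.
[cite: CoatesGreenberg1996, §2 p. 143 (iii) with Thm. 2.13] [cite: Tate1967, §3.2 Prop. 9] -/
theorem deeplyRamified_cyclotomic_trace_holds : deeplyRamified_cyclotomic_trace.{0} :=
  deeplyRamified_cyclotomic_trace_of_cyclotomicZpExtension deeplyRamified_cyclotomicZpExtension_trace_holds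

/-- **[CoGr] Cor. 3.2 for good models holds (universe `0`)**: `H1_goodModelKernel_trivial`, from (B).
[cite: CoatesGreenberg1996, Cor. 3.2 with Thm. 2.13 (through GreenbergLNM1716 pp. 83–84)] -/
theorem H1_goodModelKernel_trivial_holds : H1_goodModelKernel_trivial.{0} :=
  H1_goodModelKernel_trivial_of_cyclotomicZpExtension deeplyRamified_cyclotomicZpExtension_trace_holds

/-- **(I2) holds AS TYPED (universe `0`)**: Greenberg's input at a supersingular prime
`WeierstrassCurve.CoatesGreenberg1996_H1_formalGroup_trivial` — `H¹(K_v K_∞, 𝓕(𝔪̄)) = 0`, Coates–Greenberg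
1996 Cor. 3.2 as quoted in LNM 1716 p. 83 — is a theorem of the tree: (B)
`deeplyRamified_cyclotomicZpExtension_trace_holds` (Tate's almost étale lemma) composed with
`CoatesGreenberg1996_H1_formalGroup_trivial_of_cyclotomicZpExtension`.
[cite: CoatesGreenberg1996, Cor. 3.2 with Thm. 2.13] [cite: GreenbergLNM1716, §2 p. 83] [cite: Tate1967, §3.2 Prop. 9] -/
theorem CoatesGreenberg1996_H1_formalGroup_trivial_holds :
    WeierstrassCurve.CoatesGreenberg1996_H1_formalGroup_trivial.{0} :=
  CoatesGreenberg1996_H1_formalGroup_trivial_of_cyclotomicZpExtension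
    deeplyRamified_cyclotomicZpExtension_trace_holds

/-- **Greenberg's Thm. 1.7 (supersingular case) from (I1) alone**: for every Selmer dual datum `D` of
`E/K` (`K : Type` a number field) along a `ℤ_p`-extension, `X(E/K_∞)` is not `Λ`-torsion at a good
supersingular prime above `p`, GIVEN only the relaxed finite-level Selmer count (I1)
`relaxedSelmer_torsion_card_growth`; (I2) is supplied by `CoatesGreenberg1996_H1_formalGroup_trivial_holds`.
[cite: GreenbergLNM1716, Thm 1.7 (pp. 61–62) and §2 (p. 84)] -/
theorem not_isTorsion_of_supersingular_of_relaxedSelmer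
    {K : Type} [Field K] [NumberField K] {W : WeierstrassCurve K} {p : ℕ} [Fact p.Prime]
    {κ : ZpExtension K p} {γ : Field.absoluteGaloisGroup K} (D : WeierstrassCurve.SelmerDualData W κ γ)
    (h1 : WeierstrassCurve.relaxedSelmer_torsion_card_growth.{0}) :
    D.not_isTorsion_of_supersingular :=
  D.not_isTorsion_of_supersingular_holds_of CoatesGreenberg1996_H1_formalGroup_trivial_holds h1

/-- **Greenberg's Thm. 1.7 (supersingular case) from Poitou–Tate over the layers alone**:
`not_isTorsion_of_supersingular_of_poitouTate` with its `h2 = (I2)` discharged.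
[cite: GreenbergLNM1716, Thm 1.7 (pp. 61–62) and §2 (p. 84)] [cite: CoatesGreenberg1996, Cor. 3.2] -/
theorem not_isTorsion_of_supersingular_of_poitouTate'
    {K : Type} [Field K] [NumberField K] {W : WeierstrassCurve K} {p : ℕ} [Fact p.Prime]
    (hPT : ∀ (L : Type) [Field L] [NumberField L], Literature.NumberTheory.GaloisCohomology.poitouTate_selmerStructure_duality L)
    {κ : ZpExtension K p} {γ : Field.absoluteGaloisGroup K} (D : WeierstrassCurve.SelmerDualData W κ γ) :
    D.not_isTorsion_of_supersingular :=
  D.not_isTorsion_of_supersingular_holds_of CoatesGreenberg1996_H1_formalGroup_trivial_holds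
    (SignedEC.RelaxedKummerCount.relaxedSelmer_torsion_card_growth_of_poitouTate hPT)

end Summit.BirchSwinnertonDyer.BirchSwinnertonDyer.Theorems

end
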